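import Mathlib
import Summits.Ventures.PercRepro2.HCov
import Summits.Ventures.PercRepro2.BHKAvoid
import Summits.Ventures.PercRepro2.ExploreA3
import Summits.Ventures.PercRepro2.RootLeafUSigns
import Summits.Ventures.PercRepro2.RootLeafUHalf
import Summits.Ventures.PercRepro2.RootLeafUCore
import Summits.Ventures.PercRepro2.RootLeafUYA
import Summits.Ventures.PercRepro2.RootLeafUSepIndep
import Summits.Ventures.PercRepro2.RootLeafUSepK

/-!
# (G4-u) on the mirror separating class, part 2: `0 ≤ T2` and the class theorem (blind cell
PercRepro2, p4 g8; S3 (G4-u), proofs/P4-G8-SEP.md §6)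
The root `a₁` is a leaf at the unmarked vertex `u`, and `u` separates the root `a₂` from `c`
(`∀ ω, Conn ω a₂ c → Conn ω a₂ u`), with `pc = P(u ↔ c)`, `Z = P(Q)`.  With `RootLeafUSepK`:
* the `o ∈ L` half: `T2oL = 2 [hb Z + pc(1−Z) P(Q,bL) + κ₀ P(Q,bK)] P(PD,oL) − 2 Z (1 + κ₀) P(PD,oL,bK)`,
  `κ₀ = 1 − 2pc + pc Z = d0 − pc` (`SepK.T2oL_sepK_eq`); non-negative by the tower bound
  `P(PD,oL,bK) ≤ hb P(PD,oL)`, BHK06 Thm 1.4 with the avoided set `{a₂, c}` and Harris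
  (`SepK.T2oL_nonneg_of_sepK`, a case split on the sign of `κ₀`);
* the `o ∈ K` half: `T2oK/2 = pc(1−pc+d0)[Z P(Q,oK,bK) − P(Q,bK)P(Q,oK)] + (1−pc+pc d0)[P(Q,bL)P(Q,oK) − Z P(Q,oK,bL)]
  + (1−pc)[Z e0 P(Q,bL) − d0 Z P(Q,oK,bL)]` (`SepK.T2oK_sepK_eq`) — BHK06 Thm 1.3 on `K`, Thm 1.4, and
  `d0 · P(Q,oK,bL) ≤ e0 · P(Q,bL)` (`SepK.d0_mul_le`: trivial when `u` separates `a₂` from `o`, else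
  the `a₂`-side independence + the switching bound) (`SepK.T2oK_nonneg_of_sepK`);
* **`SepK.HCov_root_leaf_u_of_sepK`**: `0 ≤ T2`, hence (HCOV) for the root-leaf instance from (HCOV)
  for the instance `a₁ := u`, on the mirror separating class.
-/

namespace Summit.Ventures.PercRepro2

open UnionCluster CovForm

namespace RootLeafU

namespace SepK

section SepKThm

variable {V : Type*} {E : Type*} [Fintype E] [DecidableEq E] [Fintype V] [DecidableEq V]
  {R : Type*} [Field R] [LinearOrder R] [IsStrictOrderedRing R]

variable (p : E → R) (ends : E → Sym2 V) (o a₂ c b u : V)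

omit [Fintype E] [DecidableEq E] [Fintype V] in
/-- On the mirror class `PD = {u ↮ a₂, u ↮ c} = R`. -/
lemma PDEvent_eq_avoid (hsep : ∀ ω : Config E, Conn ends ω a₂ c → Conn ends ω a₂ u) :
    PDEvent ends u a₂ c = avoidAll ends u {a₂, c} := by
  ext ω
  simp only [PDEvent, Dtilde, inU, Set.mem_inter_iff, Set.mem_compl_iff, Set.mem_union,
    mem_connEvent, not_or, avoidAll, Set.mem_setOf_eq, Finset.mem_insert, Finset.mem_singleton,
    forall_eq_or_imp, forall_eq]
  constructor
  · rintro ⟨h1, h2, _⟩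
    exact ⟨h1, fun h => h2 (conn_symm h)⟩
  · rintro ⟨h1, h2⟩
    exact ⟨h1, fun h => h2 (conn_symm h), fun h => h1 (conn_symm (hsep ω (conn_symm h)))⟩

/-- **The `o ∈ L` half on the mirror class** (an identity once `T = ∅` and the `K`-side factorises). -/
theorem T2oL_sepK_eq (hsep : ∀ ω : Config E, Conn ends ω a₂ c → Conn ends ω a₂ u) (hua : u ≠ a₂) :
    T2oL p ends o a₂ c b u =
      2 * (prob p (connEvent ends a₂ b) * prob p (avoidAll ends a₂ {u}) +
            prob p (connEvent ends u c) * (1 - prob p (avoidAll ends a₂ {u})) *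
              prob p (avoidAll ends a₂ {u} ∩ connEvent ends u b) +
            (1 - 2 * prob p (connEvent ends u c) +
              prob p (connEvent ends u c) * prob p (avoidAll ends a₂ {u})) *
              prob p (avoidAll ends a₂ {u} ∩ connEvent ends a₂ b)) *
          prob p (PDEvent ends u a₂ c ∩ connEvent ends u o) -
        2 * (prob p (avoidAll ends a₂ {u}) *
            (2 - 2 * prob p (connEvent ends u c) +
              prob p (connEvent ends u c) * prob p (avoidAll ends a₂ {u}))) *
          prob p (PDEvent ends u a₂ c ∩ (connEvent ends u o ∩ connEvent ends a₂ b)) := by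
  have hT := TEvent_eq_empty ends a₂ c u hsep
  have hgap := gap_eq_Q p ends u a₂ b
  have hbL := Qsplit p ends u a₂ c (connEvent ends u b)
  have hTpbK := prob_Tp_clusterInK_eq p ends a₂ c u hsep hua {W | b ∈ W}
  have hPDbK := prob_PD_clusterInK_eq p ends a₂ c u hsep hua {W | b ∈ W}
  have hTp := prob_Tp_clusterInK_eq p ends a₂ c u hsep hua Set.univ
  have hD := prob_PD_clusterInK_eq p ends a₂ c u hsep hua Set.univ
  have hd0 := d0_eq p ends a₂ c u hsep hua
  rw [ExploreA3.clusterInEvent_mem_eq] at hTpbK hPDbK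
  rw [clusterInEvent_univ, Set.inter_univ, Set.inter_univ] at hTp hD
  rw [hT, Set.empty_inter, prob_empty, add_zero] at hbL
  have hTpbL : prob p (TEvent ends a₂ u c ∩ connEvent ends u b) =
      prob p (avoidAll ends a₂ {u} ∩ connEvent ends u b) -
        prob p (PDEvent ends u a₂ c ∩ connEvent ends u b) := by linarith
  unfold T2oL EQb3 PDb EQ3
  rw [prob_univ, hgap]
  simp only [hT, Set.empty_inter, prob_empty]
  rw [hTpbK, hPDbK, hTp, hD, hd0, hTpbL]
  ring

/-- **The `o ∈ L` half is non-negative on the mirror class.** -/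
theorem T2oL_nonneg_of_sepK (hp : IsProbVec p)
    (hsep : ∀ ω : Config E, Conn ends ω a₂ c → Conn ends ω a₂ u) (hua : u ≠ a₂) :
    0 ≤ T2oL p ends o a₂ c b u := by
  rw [T2oL_sepK_eq p ends o a₂ c b u hsep hua]
  have hPD := PDEvent_eq_avoid ends a₂ c u hsep
  -- the tower bound `P(PD, oL, bK) ≤ hb · P(PD, oL)`
  have ht := prob_R_oL_bK_le p ends o a₂ c b u hp
  rw [← hPD] at ht
  -- BHK06 Thm 1.4 with the avoided set `{a₂, c}`: `P(PD, oL, bK) · D ≤ P(PD, oL) · P(PD, bK)`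
  have ha2 : a₂ ∈ ({a₂, c} : Finset V) := by simp
  have hbhk := bhk_cross_cluster_avoid p hp ends u a₂ ha2 (𝓤 := {W | o ∈ W}) (𝓥 := {W | b ∈ W})
    (fun _ _ h hW => h hW) (fun _ _ h hW => h hW)
  rw [ExploreA3.clusterInEvent_mem_eq, ExploreA3.clusterInEvent_mem_eq, ← hPD] at hbhk
  have e1 : connEvent ends u o ∩ connEvent ends a₂ b ∩ PDEvent ends u a₂ c =
      PDEvent ends u a₂ c ∩ (connEvent ends u o ∩ connEvent ends a₂ b) := Set.inter_comm _ _
  have e2 : connEvent ends u o ∩ PDEvent ends u a₂ c =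
      PDEvent ends u a₂ c ∩ connEvent ends u o := Set.inter_comm _ _
  have e3 : connEvent ends a₂ b ∩ PDEvent ends u a₂ c =
      PDEvent ends u a₂ c ∩ connEvent ends a₂ b := Set.inter_comm _ _
  rw [e1, e2, e3] at hbhk
  have hPDbK := prob_PD_clusterInK_eq p ends a₂ c u hsep hua {W | b ∈ W}
  have hD := prob_PD_clusterInK_eq p ends a₂ c u hsep hua Set.univ
  rw [ExploreA3.clusterInEvent_mem_eq] at hPDbK
  rw [clusterInEvent_univ, Set.inter_univ, Set.inter_univ] at hD
  rw [hPDbK, hD] at hbhk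
  -- Harris: `P(Q, bK) ≤ Z · hb`
  have hQ : IsLowerSet (avoidAll ends a₂ {u}) := by
    rw [avoidAll_singleton_eq ends]
    exact (isUpperSet_connEvent ends a₂ u).compl
  have hh := prob_inter_le_prob_mul_prob_of_isLowerSet hp hQ (isUpperSet_connEvent ends a₂ b)
  -- names
  set X := prob p (PDEvent ends u a₂ c ∩ (connEvent ends u o ∩ connEvent ends a₂ b)) with hX
  set Y := prob p (PDEvent ends u a₂ c ∩ connEvent ends u o) with hY
  set Z := prob p (avoidAll ends a₂ {u}) with hZ
  set pc := prob p (connEvent ends u c) with hpc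
  set hb := prob p (connEvent ends a₂ b) with hhb
  set QbK := prob p (avoidAll ends a₂ {u} ∩ connEvent ends a₂ b) with hQbK
  set QbL := prob p (avoidAll ends a₂ {u} ∩ connEvent ends u b) with hQbL
  have hX0 : 0 ≤ X := prob_nonneg hp _
  have hY0 : 0 ≤ Y := prob_nonneg hp _
  have hZ0 : 0 ≤ Z := prob_nonneg hp _
  have hZ1 : Z ≤ 1 := prob_le_one hp _
  have hpc0 : 0 ≤ pc := prob_nonneg hp _
  have hpc1 : pc ≤ 1 := prob_le_one hp _
  have hhb0 : 0 ≤ hb := prob_nonneg hp _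
  have hQbL0 : 0 ≤ QbL := prob_nonneg hp _
  have hQbK0 : 0 ≤ QbK := prob_nonneg hp _
  -- `Y ≤ D`
  have hYD : Y ≤ (1 - pc) * Z := by
    rw [← hD]
    exact prob_mono hp Set.inter_subset_left
  -- the two cases on the sign of `κ₀ = 1 − 2pc + pc Z`
  rcases le_or_gt 0 (1 - 2 * pc + pc * Z) with hk | hk
  · -- `κ₀ ≥ 0`: `Z X ≤ hb Z Y` and `κ₀ Z X ≤ κ₀ QbK Y` (the latter through `(1 − pc)`)
    rcases lt_or_eq_of_le hpc1 with hpc | hpc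
    · have h1 : Z * X ≤ QbK * Y := by
        have h1' : (1 - pc) * (Z * X) ≤ (1 - pc) * (QbK * Y) := by nlinarith [hbhk]
        exact le_of_mul_le_mul_left h1' (by linarith)
      have h2' := mul_le_mul_of_nonneg_left ht hZ0
      have h3' := mul_le_mul_of_nonneg_left h1 hk
      have hpos : 0 ≤ pc * ((1 - Z) * (QbL * Y)) :=
        mul_nonneg hpc0 (mul_nonneg (sub_nonneg.2 hZ1) (mul_nonneg hQbL0 hY0))
      linear_combination 2 * h2' + 2 * h3' + 2 * hpos
    · have hY' : Y = 0 := le_antisymm (by rw [hpc] at hYD; simpa using hYD) hY0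
      have hX' : X = 0 := le_antisymm (by rw [hY'] at ht; simpa using ht) hX0
      rw [hY', hX']
      ring_nf
      exact le_refl _
  · -- `κ₀ < 0`: `β X ≤ β hb Y` and `κ₀ hb Z ≤ κ₀ QbK`
    have hβ : 0 ≤ Z * (2 - 2 * pc + pc * Z) := mul_nonneg hZ0 (by nlinarith)
    have h1 : Z * (2 - 2 * pc + pc * Z) * X ≤ Z * (2 - 2 * pc + pc * Z) * (hb * Y) :=
      mul_le_mul_of_nonneg_left ht hβ
    have h2 : (1 - 2 * pc + pc * Z) * (hb * Z) ≤ (1 - 2 * pc + pc * Z) * QbK := by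
      have := mul_le_mul_of_nonneg_left hh (show (0 : R) ≤ -(1 - 2 * pc + pc * Z) by linarith)
      linarith
    have h2' := mul_le_mul_of_nonneg_right h2 hY0
    have hpos : 0 ≤ pc * ((1 - Z) * (QbL * Y)) :=
      mul_nonneg hpc0 (mul_nonneg (sub_nonneg.2 hZ1) (mul_nonneg hQbL0 hY0))
    linear_combination 2 * h1 + 2 * h2' + 2 * hpos

/-- **The `o ∈ K` half on the mirror class** (an identity once `T = ∅` and the `K`-side factorises). -/
theorem T2oK_sepK_eq (hsep : ∀ ω : Config E, Conn ends ω a₂ c → Conn ends ω a₂ u) (hua : u ≠ a₂) :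
    T2oK p ends o a₂ c b u =
      2 * (prob p (connEvent ends u c) * (2 - 2 * prob p (connEvent ends u c) +
            prob p (connEvent ends u c) * prob p (avoidAll ends a₂ {u})) *
          (prob p (avoidAll ends a₂ {u}) *
              prob p (avoidAll ends a₂ {u} ∩ (connEvent ends a₂ o ∩ connEvent ends a₂ b)) -
            prob p (avoidAll ends a₂ {u} ∩ connEvent ends a₂ b) *
              prob p (avoidAll ends a₂ {u} ∩ connEvent ends a₂ o)) +
        (1 - prob p (connEvent ends u c) ^ 2 +
            prob p (connEvent ends u c) ^ 2 * prob p (avoidAll ends a₂ {u})) *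
          (prob p (avoidAll ends a₂ {u} ∩ connEvent ends u b) *
              prob p (avoidAll ends a₂ {u} ∩ connEvent ends a₂ o) -
            prob p (avoidAll ends a₂ {u}) *
              prob p (avoidAll ends a₂ {u} ∩ (connEvent ends a₂ o ∩ connEvent ends u b))) +
        (1 - prob p (connEvent ends u c)) *
          (prob p (avoidAll ends a₂ {u}) * prob p (avoidAll ends a₂ {c} ∩ connEvent ends a₂ o) *
              prob p (avoidAll ends a₂ {u} ∩ connEvent ends u b) -
            (1 - prob p (connEvent ends u c) +
                prob p (connEvent ends u c) * prob p (avoidAll ends a₂ {u})) *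
              prob p (avoidAll ends a₂ {u}) *
              prob p (avoidAll ends a₂ {u} ∩ (connEvent ends a₂ o ∩ connEvent ends u b)))) := by
  have hT := TEvent_eq_empty ends a₂ c u hsep
  have hgap := gap_eq_Q p ends u a₂ b
  have hbL := Qsplit p ends u a₂ c (connEvent ends u b)
  have hoKbL := Qsplit p ends u a₂ c (connEvent ends a₂ o ∩ connEvent ends u b)
  have hTpbK := prob_Tp_clusterInK_eq p ends a₂ c u hsep hua {W | b ∈ W}
  have hPDbK := prob_PD_clusterInK_eq p ends a₂ c u hsep hua {W | b ∈ W}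
  have hTpoK := prob_Tp_clusterInK_eq p ends a₂ c u hsep hua {W | o ∈ W}
  have hPDoK := prob_PD_clusterInK_eq p ends a₂ c u hsep hua {W | o ∈ W}
  have hTpoKbK := prob_Tp_clusterInK_eq p ends a₂ c u hsep hua ({W | o ∈ W} ∩ {W | b ∈ W})
  have hTp := prob_Tp_clusterInK_eq p ends a₂ c u hsep hua Set.univ
  have hD := prob_PD_clusterInK_eq p ends a₂ c u hsep hua Set.univ
  have hd0 := d0_eq p ends a₂ c u hsep hua
  rw [ExploreA3.clusterInEvent_mem_eq] at hTpbK hPDbK hTpoK hPDoK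
  rw [clusterInEvent_mem_inter_eq] at hTpoKbK
  rw [clusterInEvent_univ, Set.inter_univ, Set.inter_univ] at hTp hD
  rw [hT, Set.empty_inter, prob_empty, add_zero] at hbL hoKbL
  have hTpbL : prob p (TEvent ends a₂ u c ∩ connEvent ends u b) =
      prob p (avoidAll ends a₂ {u} ∩ connEvent ends u b) -
        prob p (PDEvent ends u a₂ c ∩ connEvent ends u b) := by linarith
  have hTpoKbL : prob p (TEvent ends a₂ u c ∩ (connEvent ends a₂ o ∩ connEvent ends u b)) =
      prob p (avoidAll ends a₂ {u} ∩ (connEvent ends a₂ o ∩ connEvent ends u b)) -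
        prob p (PDEvent ends u a₂ c ∩ (connEvent ends a₂ o ∩ connEvent ends u b)) := by linarith
  unfold T2oK Ee EQb3 PDb EQ3
  rw [prob_univ, hgap]
  simp only [hT, Set.empty_inter, prob_empty]
  rw [hTpbK, hPDbK, hTpoK, hPDoK, hTpoKbK, hTp, hD, hd0, hTpbL, hTpoKbL]
  ring

/-- `d0 · P(Q, bL, oK) ≤ e0 · P(Q, bL)` on the mirror class (the side of `o` decides). -/
theorem d0_mul_le (hp : IsProbVec p)
    (hsep : ∀ ω : Config E, Conn ends ω a₂ c → Conn ends ω a₂ u) (hua : u ≠ a₂) :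
    prob p (avoidAll ends a₂ {c}) *
        prob p (avoidAll ends a₂ {u} ∩ connEvent ends u b ∩ connEvent ends a₂ o) ≤
      prob p (avoidAll ends a₂ {c} ∩ connEvent ends a₂ o) *
        prob p (avoidAll ends a₂ {u} ∩ connEvent ends u b) := by
  rcases sep_or_mem_side (ends := ends) (E := E) u a₂ o with hA | hB
  · have h0 : avoidAll ends a₂ {u} ∩ connEvent ends u b ∩ connEvent ends a₂ o = ∅ := by
      ext ω
      simp only [Set.mem_inter_iff, mem_connEvent, Set.mem_empty_iff_false, iff_false, not_and]
      intro hQ ho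
      exact hQ.1 u (Finset.mem_singleton_self u) (hA ω ho)
    rw [h0, prob_empty, mul_zero]
    exact mul_nonneg (prob_nonneg hp _) (prob_nonneg hp _)
  · rw [d0_eq p ends a₂ c u hsep hua, e0_eq p ends o a₂ c u hsep hua hB]
    have h1 := bhk_cross_cluster p hp ends a₂ u (𝓤 := {W | o ∈ W}) (𝓥 := {W | b ∈ W})
      (fun _ _ h hW => h hW) (fun _ _ h hW => h hW)
    rw [ExploreA3.clusterInEvent_mem_eq, ExploreA3.clusterInEvent_mem_eq,
      ← avoidAll_singleton_eq ends a₂ u] at h1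
    have e1 : connEvent ends a₂ o ∩ connEvent ends u b ∩ avoidAll ends a₂ {u} =
        avoidAll ends a₂ {u} ∩ connEvent ends u b ∩ connEvent ends a₂ o := by
      ext ω; simp only [Set.mem_inter_iff]; tauto
    have e2 : connEvent ends a₂ o ∩ avoidAll ends a₂ {u} =
        avoidAll ends a₂ {u} ∩ connEvent ends a₂ o := Set.inter_comm _ _
    have e3 : connEvent ends u b ∩ avoidAll ends a₂ {u} =
        avoidAll ends a₂ {u} ∩ connEvent ends u b := Set.inter_comm _ _
    rw [e1, e2, e3] at h1
    have h2 := switch_le p ends o a₂ b u hp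
    have hpc1 : 0 ≤ 1 - prob p (connEvent ends u c) := by linarith [prob_le_one hp (connEvent ends u c)]
    have h3 := mul_le_mul_of_nonneg_left h2 hpc1
    nlinarith [h1, h3]

/-- **The `o ∈ K` half is non-negative on the mirror class.** -/
theorem T2oK_nonneg_of_sepK (hp : IsProbVec p)
    (hsep : ∀ ω : Config E, Conn ends ω a₂ c → Conn ends ω a₂ u) (hua : u ≠ a₂) :
    0 ≤ T2oK p ends o a₂ c b u := by
  rw [T2oK_sepK_eq p ends o a₂ c b u hsep hua]
  -- BHK06 Thm 1.3 on the cluster of `a₂`: `P(Q,oK) P(Q,bK) ≤ P(Q,oK,bK) Z`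
  have h13 := bhk_same_cluster_events p hp ends a₂ u (𝓤 := {W | o ∈ W}) (𝓥 := {W | b ∈ W})
    (fun _ _ h hW => h hW) (fun _ _ h hW => h hW)
  rw [ExploreA3.clusterInEvent_mem_eq, ExploreA3.clusterInEvent_mem_eq,
    ← avoidAll_singleton_eq ends a₂ u] at h13
  have e1 : connEvent ends a₂ o ∩ avoidAll ends a₂ {u} =
      avoidAll ends a₂ {u} ∩ connEvent ends a₂ o := Set.inter_comm _ _
  have e2 : connEvent ends a₂ b ∩ avoidAll ends a₂ {u} =
      avoidAll ends a₂ {u} ∩ connEvent ends a₂ b := Set.inter_comm _ _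
  have e3 : connEvent ends a₂ o ∩ connEvent ends a₂ b ∩ avoidAll ends a₂ {u} =
      avoidAll ends a₂ {u} ∩ (connEvent ends a₂ o ∩ connEvent ends a₂ b) := Set.inter_comm _ _
  rw [e1, e2, e3] at h13
  -- BHK06 Thm 1.4: `Z P(Q,oK,bL) ≤ P(Q,oK) P(Q,bL)`
  have h14 := bhk_cross_cluster p hp ends a₂ u (𝓤 := {W | o ∈ W}) (𝓥 := {W | b ∈ W})
    (fun _ _ h hW => h hW) (fun _ _ h hW => h hW)
  rw [ExploreA3.clusterInEvent_mem_eq, ExploreA3.clusterInEvent_mem_eq,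
    ← avoidAll_singleton_eq ends a₂ u] at h14
  have e4 : connEvent ends a₂ o ∩ connEvent ends u b ∩ avoidAll ends a₂ {u} =
      avoidAll ends a₂ {u} ∩ (connEvent ends a₂ o ∩ connEvent ends u b) := Set.inter_comm _ _
  have e5 : connEvent ends u b ∩ avoidAll ends a₂ {u} =
      avoidAll ends a₂ {u} ∩ connEvent ends u b := Set.inter_comm _ _
  rw [e4, e1, e5] at h14
  -- `d0 P(Q,bL,oK) ≤ e0 P(Q,bL)`
  have hb' := d0_mul_le p ends o a₂ c b u hp hsep hua
  have e6 : avoidAll ends a₂ {u} ∩ connEvent ends u b ∩ connEvent ends a₂ o =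
      avoidAll ends a₂ {u} ∩ (connEvent ends a₂ o ∩ connEvent ends u b) := by
    ext ω; simp only [Set.mem_inter_iff]; tauto
  rw [e6, d0_eq p ends a₂ c u hsep hua] at hb'
  have hpc0 : 0 ≤ prob p (connEvent ends u c) := prob_nonneg hp _
  have hpc1 : prob p (connEvent ends u c) ≤ 1 := prob_le_one hp _
  have hZ0 : 0 ≤ prob p (avoidAll ends a₂ {u}) := prob_nonneg hp _
  have hZ1 : prob p (avoidAll ends a₂ {u}) ≤ 1 := prob_le_one hp _
  have c1 : 0 ≤ prob p (connEvent ends u c) * (2 - 2 * prob p (connEvent ends u c) +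
      prob p (connEvent ends u c) * prob p (avoidAll ends a₂ {u})) :=
    mul_nonneg hpc0 (by nlinarith)
  have c2 : 0 ≤ 1 - prob p (connEvent ends u c) ^ 2 +
      prob p (connEvent ends u c) ^ 2 * prob p (avoidAll ends a₂ {u}) := by nlinarith
  have c3 : 0 ≤ 1 - prob p (connEvent ends u c) := by linarith
  have t1 := mul_le_mul_of_nonneg_left h13 c1
  have t2 := mul_le_mul_of_nonneg_left h14 c2
  have t3 := mul_le_mul_of_nonneg_left (mul_le_mul_of_nonneg_left hb' hZ0) c3
  nlinarith [t1, t2, t3]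

/-- **`0 ≤ T2` on the mirror separating class.** -/
theorem T2_nonneg_of_sepK (hp : IsProbVec p)
    (hsep : ∀ ω : Config E, Conn ends ω a₂ c → Conn ends ω a₂ u) (hua : u ≠ a₂) :
    0 ≤ T2 p ends o a₂ c b u :=
  T2_nonneg_of_halves p ends o a₂ c b u (T2oL_nonneg_of_sepK p ends o a₂ c b u hp hsep hua)
    (T2oK_nonneg_of_sepK p ends o a₂ c b u hp hsep hua)

/-- **(G4-u) on the mirror separating class**: for the root `a₁` a leaf at the unmarked vertex `u`
(edge `f`), if `u` separates the root `a₂` from `c` (every configuration with `a₂ ↔ c` has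
`a₂ ↔ u`), then (HCOV) for the root-leaf instance follows from (HCOV) for the instance `a₁ := u`. -/
theorem HCov_root_leaf_u_of_sepK (hp : IsProbVec p) {f : E} {a₁ : V} (hf : ends f = s(a₁, u))
    (hleaf : ∀ e, a₁ ∈ ends e → e = f) (h1u : a₁ ≠ u) (h12 : a₁ ≠ a₂) (h1c : a₁ ≠ c)
    (h1o : a₁ ≠ o) (h1b : a₁ ≠ b) (hua : u ≠ a₂)
    (hsep : ∀ ω : Config E, Conn ends ω a₂ c → Conn ends ω a₂ u)
    (h3 : HCov p ends o u a₂ c b) : HCov p ends o a₁ a₂ c b :=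
  HCov_root_leaf_u_of p ends hp hf hleaf h1u h12 h1c h1o h1b
    (T2_nonneg_of_sepK p ends o a₂ c b u hp hsep hua) h3

end SepKThm

end SepK

end RootLeafU

end Summit.Ventures.PercRepro2
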